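import Mathlib
import HarnessLib
import Summits.CriticalPhenomena.Ising3DConformalLimit.Theses.PlantedPinning

/-!
# Strategy census s3 — typed artefacts for the crux `PinningEfficiencyDeficit`
(item `stmt-CriticalPhenomena-8451`, route `route-CriticalPhenomena-PlantedPinning`)

Seat `cstrat-stmt-CriticalPhenomena-8451-s3` (independent strategy census, family `s`).
This scratch file holds the Lean signatures quoted in `STRATEGY-CENSUS-s3.md`.  Nothing here is a
route item; the crux itself is FIXED and is never restated.

* `PinningEfficiencyDeficitFreq` — the WEAKEST replacement of the crux that still closes the route
  with the same partners (`closes_freq`, proved), with `freq_of_deficit : PED → PED_freq` (proved);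
* `LockingResponse` — the two-bin ("value-locking") form of the Cauchy–Schwarz slack: the best
  typed decomposition found is  S1 ⇐ LockingResponse + `relVar_of_twoBin` + bookkeeping;
* `var_ge_twoBin`, `relVar_of_twoBin` — the abstract halves of that split, PROVED here;
* `BinderCumulantFloor`, `PinningStabilityBridge` — the bridge split of `## Decomposition`.
-/

namespace Summit.CriticalPhenomena.Ising3DConformalLimit.Cruxes.PinningEfficiencyDeficit.StratS3

open Finset
open Literature.Probability.LatticeModels
open Summit.CriticalPhenomena.Ising3DConformalLimit.Theses.PlantedPinning

noncomputable section

/-! ## 1. Weakest intermediate: the frequent ("along a sequence") deficit -/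

/-- `PED_freq`: the negation of the conclusion of `GaussianPinningSaturation`, verbatim over the
route's `let`-tower: SOME ε > 0 such that for arbitrarily small `p` the efficiency
`e_L(⌈p·n⌉)` dips below `1 − ε` for arbitrarily large `L`.  This is the weakest statement that can
replace the crux in `closes` without touching the partners r3/r5 (see `closes_freq`). -/
def PinningEfficiencyDeficitFreq : Prop :=
  let βc : ℝ := Literature.Probability.LatticeModels.criticalBeta 3; let M : ℕ → Literature.Probability.LatticeModels.SpinConfig (Literature.Probability.LatticeModels.Site 3) → ℝ := fun L σ => ∑ x ∈ Literature.Probability.LatticeModels.box 3 L, Literature.Probability.LatticeModels.spinAt x σ; let cvar : ℕ → Finset (Literature.Probability.LatticeModels.Site 3) → Literature.Probability.LatticeModels.SpinConfig (Literature.Probability.LatticeModels.Site 3) → ℝ := fun L P η => Literature.Probability.LatticeModels.isingExpect (Literature.Probability.LatticeModels.zdGraph 3) (Literature.Probability.LatticeModels.box 3 L \ P) βc 0 (.fixed η) (fun σ => M L σ ^ 2) - Literature.Probability.LatticeModels.isingExpect (Literature.Probability.LatticeModels.zdGraph 3) (Literature.Probability.LatticeModels.box 3 L \ P) βc 0 (.fixed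 η) (M L) ^ 2; let pvar : ℕ → ℕ → ℝ := fun L k => (∑ P ∈ (Literature.Probability.LatticeModels.box 3 L).powersetCard k, ∑ τ : ↥(Literature.Probability.LatticeModels.box 3 L) → ℤˣ, Literature.Probability.LatticeModels.isingWeight (Literature.Probability.LatticeModels.zdGraph 3) (Literature.Probability.LatticeModels.box 3 L) βc 0 .plus τ / Literature.Probability.LatticeModels.isingPartitionFunction (Literature.Probability.LatticeModels.zdGraph 3) (Literature.Probability.LatticeModels.box 3 L) βc 0 .plus * cvar L P (Literature.Probability.LatticeModels.glue (Literature.Probability.LatticeModels.box 3 L) τ .plus)) / ((Literature.Probability.LatticeModels.box 3 L).card.choose k : ℝ); let eff : ℕ → ℕ → ℝ := fun L k => (k : ℝ) * pvar L k / ((((Literature.Probability.LatticeModels.box 3 L).card : ℝ) + 1) * (((Literature.Probability.LatticeModels.box 3 L).card : ℝ) - k + 1)); ∃ ε : ℝ, 0 < ε ∧ ∀ p₀ : ℝ, 0 < p₀ → ∃ p : ℝ, 0 < p ∧ p < p₀ ∧ ∀ L₀ : ℕ, ∃ L ≥ L₀, eff L ⌈p * ((Literature.Probability.LatticeModels.box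 3 L).card : ℝ)⌉₊ ≤ 1 - ε

/-- The route closes identically from the weaker `PED_freq` (same proof shape as the gate's
`closes`): a Gaussian Möbius limit would force `1 − ε/2 ≤ e` eventually for every small `p`,
contradicting a dip `e ≤ 1 − ε` along one sequence. -/
theorem closes_freq : PinningEfficiencyDeficitFreq → GaussianPinningSaturation → MoebiusLimitExists →
    _root_.Ising3DConformalLimit := by
  intro hDef hSat hMoeb
  obtain ⟨ρ, Δ, S, hρ, hΔ, hlim, hnd, hmob⟩ := hMoeb
  refine ⟨ρ, Δ, S, hρ, hΔ, hlim, hnd, hmob, ?_⟩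
  by_contra hU4
  obtain ⟨ε, hε, hdef⟩ := hDef
  obtain ⟨p₁, hp₁, hsat⟩ := hSat ρ Δ S hρ hΔ hlim hnd hmob hU4 (ε / 2) (by linarith)
  obtain ⟨p, hp, hpp, hfreq⟩ := hdef p₁ hp₁
  obtain ⟨L₁, hL₁⟩ := hsat p hp hpp
  obtain ⟨L, hL, hdefL⟩ := hfreq L₁
  have h₁ := hL₁ L hL
  linarith

/-- The crux as filed implies its frequent form (so `PED_freq` is genuinely weaker-or-equal). -/
theorem freq_of_deficit : PinningEfficiencyDeficit → PinningEfficiencyDeficitFreq := by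
  intro hDef
  obtain ⟨ε, hε, p₀, hp₀, hdef⟩ := hDef
  refine ⟨ε, hε, fun p₁ hp₁ => ?_⟩
  have hmin : 0 < min p₀ p₁ := lt_min hp₀ hp₁
  have hle₀ : min p₀ p₁ ≤ p₀ := min_le_left p₀ p₁
  have hle₁ : min p₀ p₁ ≤ p₁ := min_le_right p₀ p₁
  obtain ⟨L₁, hL₁⟩ := hdef (min p₀ p₁ / 2) (by linarith) (by linarith)
  refine ⟨min p₀ p₁ / 2, by linarith, by linarith, fun L₀ => ?_⟩
  exact ⟨max L₀ L₁, le_max_left L₀ L₁, hL₁ (max L₀ L₁) (le_max_right L₀ L₁)⟩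

/-! ## 2. Decomposition: the two-bin locking response and its proved abstract half -/

/-- `β_c(3)`. -/
abbrev βc : ℝ := criticalBeta 3

/-- Total magnetisation of the box `Λ_L`. -/
def Mtot (L : ℕ) (σ : SpinConfig (Site 3)) : ℝ := ∑ x ∈ box 3 L, spinAt x σ

/-- Planted-pattern weight `w(τ) = μ⁺_{Λ_L;β_c,0}(τ)`. -/
def wt (L : ℕ) (τ : ↥(box 3 L) → ℤˣ) : ℝ :=
  isingWeight (zdGraph 3) (box 3 L) βc 0 .plus τ / isingPartitionFunction (zdGraph 3) (box 3 L) βc 0 .plus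

/-- Conditional (pinned) expectation `E[f | σ_P = τ_P]` = Ising expectation on `Λ_L ∖ P` with the
boundary condition fixed to `glue Λ_L τ plus` (the DLR identity used by r2–r4). -/
def Epin (L : ℕ) (P : Finset (Site 3)) (τ : ↥(box 3 L) → ℤˣ) (f : SpinConfig (Site 3) → ℝ) : ℝ :=
  isingExpect (zdGraph 3) (box 3 L \ P) βc 0 (.fixed (glue (box 3 L) τ .plus)) f

/-- Local pinned magnetisation `m_z(P,τ) = E[σ_z | pins]`. -/
def mloc (L : ℕ) (P : Finset (Site 3)) (τ : ↥(box 3 L) → ℤˣ) (z : Site 3) : ℝ :=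
  Epin L P τ (spinAt z)

/-- Local pinned susceptibility `χ_z(P,τ) = Cov(M, σ_z | pins)` (the summand of `csq`). -/
def chi (L : ℕ) (P : Finset (Site 3)) (τ : ↥(box 3 L) → ℤˣ) (z : Site 3) : ℝ :=
  Epin L P τ (fun σ => Mtot L σ * spinAt z σ) - Epin L P τ (Mtot L) * Epin L P τ (spinAt z)

/-- The planted triple average `E_W[f] = (n choose j)⁻¹ Σ_{|P|=j} Σ_τ w(τ) (n−j)⁻¹ Σ_{z∈Λ∖P} f(P,τ,z)`;
with it `pvar L j = (n−j)·E_W[chi]` and `csq L j = (n−j)²·E_W[chi²]`, so the slack window S1 reads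
`Var_W(chi) ≥ s·E_W[chi]²`. -/
def tripleAvg (L j : ℕ) (f : Finset (Site 3) → (↥(box 3 L) → ℤˣ) → Site 3 → ℝ) : ℝ :=
  (∑ P ∈ (box 3 L).powersetCard j, ∑ τ : ↥(box 3 L) → ℤˣ,
      wt L τ * ((((box 3 L).card : ℝ) - j)⁻¹ * ∑ z ∈ box 3 L \ P, f P τ z)) / ((box 3 L).card.choose j : ℝ)

/-- LOCKING RESPONSE (two-bin form; the residual hard piece of the best decomposition found).
In the S1 window `⌈pn⌉ ≤ 2j < 2⌈pn⌉`, uniformly in small `p` and large `L`: the bin of unpinned sites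
whose pinned local magnetisation is large (`m_z² > θ`, "value-locked" sites) carries `W`-mass in
`[b, 1−b]`, and its mean local susceptibility is at most `(1−c)` times that of the complementary bin:
`E_W[χ | m² > θ] ≤ (1−c)·E_W[χ | m² ≤ θ]` (written division-free). By `relVar_of_twoBin` this gives
S1 with `s = c²·b(1−b)`.  It is the quantitative statement "screening of the critical 3D Ising
state by planted pins is VALUE-dependent at the crossover scale", i.e. IR non-Gaussianity. -/
def LockingResponse : Prop :=
  ∃ θ : ℝ, 0 < θ ∧ θ < 1 ∧ ∃ c : ℝ, 0 < c ∧ c ≤ 1 ∧ ∃ b : ℝ, 0 < b ∧ ∃ p₀ : ℝ, 0 < p₀ ∧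
    ∀ p : ℝ, 0 < p → p < p₀ → ∃ L₀ : ℕ, ∀ L ≥ L₀, ∀ j : ℕ,
      ⌈p * ((box 3 L).card : ℝ)⌉₊ ≤ 2 * j → j < ⌈p * ((box 3 L).card : ℝ)⌉₊ →
      let hi : Finset (Site 3) → (↥(box 3 L) → ℤˣ) → Site 3 → ℝ :=
        fun P τ z => if θ < mloc L P τ z ^ 2 then 1 else 0
      b ≤ tripleAvg L j hi ∧ tripleAvg L j hi ≤ 1 - b ∧
      (1 - tripleAvg L j hi) * tripleAvg L j (fun P τ z => hi P τ z * chi L P τ z) ≤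
        (1 - c) * tripleAvg L j hi * tripleAvg L j (fun P τ z => (1 - hi P τ z) * chi L P τ z)

/-- TWO-BIN VARIANCE BOUND (law of total variance, division-free, PROVED): for a probability weight
`w` on `s` and a bin `A ⊆ s`, with `a = w(A)`, `S_A = Σ_A w x`, `S_B = Σ_{s∖A} w x`,
`((1−a)·S_A − a·S_B)² ≤ a(1−a)·(Σ_s w x² − (Σ_s w x)²)`. -/
theorem var_ge_twoBin {ι : Type*} [DecidableEq ι] (s A : Finset ι) (hA : A ⊆ s) (w x : ι → ℝ)
    (hw : ∀ i ∈ s, 0 ≤ w i) (hw1 : ∑ i ∈ s, w i = 1) :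
    ((1 - ∑ i ∈ A, w i) * (∑ i ∈ A, w i * x i) - (∑ i ∈ A, w i) * (∑ i ∈ s \ A, w i * x i)) ^ 2 ≤
      (∑ i ∈ A, w i) * (1 - ∑ i ∈ A, w i) *
        (∑ i ∈ s, w i * x i ^ 2 - (∑ i ∈ s, w i * x i) ^ 2) := by
  have hsplit : ∀ f : ι → ℝ, ∑ i ∈ s, f i = ∑ i ∈ A, f i + ∑ i ∈ s \ A, f i := fun f => by
    rw [← Finset.sum_union Finset.disjoint_sdiff, Finset.union_sdiff_of_subset hA]
  have hwB : ∀ i ∈ s \ A, 0 ≤ w i := fun i hi => hw i (Finset.mem_sdiff.1 hi).1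
  have hwA : ∀ i ∈ A, 0 ≤ w i := fun i hi => hw i (hA hi)
  -- abbreviations as equations
  obtain ⟨a, ha⟩ : ∃ a : ℝ, a = ∑ i ∈ A, w i := ⟨_, rfl⟩
  obtain ⟨SA, hSA⟩ : ∃ t : ℝ, t = ∑ i ∈ A, w i * x i := ⟨_, rfl⟩
  obtain ⟨SB, hSB⟩ : ∃ t : ℝ, t = ∑ i ∈ s \ A, w i * x i := ⟨_, rfl⟩
  obtain ⟨μ, hμ⟩ : ∃ t : ℝ, t = ∑ i ∈ s, w i * x i := ⟨_, rfl⟩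
  obtain ⟨Q, hQ⟩ : ∃ t : ℝ, t = ∑ i ∈ s, w i * x i ^ 2 := ⟨_, rfl⟩
  obtain ⟨VA, hVA⟩ : ∃ t : ℝ, t = ∑ i ∈ A, w i * (x i - μ) ^ 2 := ⟨_, rfl⟩
  obtain ⟨VB, hVB⟩ : ∃ t : ℝ, t = ∑ i ∈ s \ A, w i * (x i - μ) ^ 2 := ⟨_, rfl⟩
  have hμAB : μ = SA + SB := by rw [hμ, hSA, hSB]; exact hsplit _
  have haB : ∑ i ∈ s \ A, w i = 1 - a := by have := hsplit w; rw [hw1] at this; rw [ha]; linarith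
  have ha0 : 0 ≤ a := by rw [ha]; exact Finset.sum_nonneg hwA
  have hB0 : 0 ≤ 1 - a := by rw [← haB]; exact Finset.sum_nonneg hwB
  -- the first conditional moment deviations
  have hDA : ∑ i ∈ A, w i * (x i - μ) = (1 - a) * SA - a * SB := by
    have : ∑ i ∈ A, w i * (x i - μ) = ∑ i ∈ A, w i * x i - μ * ∑ i ∈ A, w i := by
      rw [Finset.mul_sum, ← Finset.sum_sub_distrib]
      exact Finset.sum_congr rfl fun i _ => by ring
    rw [this, ← hSA, ← ha, hμAB]; ring
  have hDB : ∑ i ∈ s \ A, w i * (x i - μ) = -((1 - a) * SA - a * SB) := by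
    have : ∑ i ∈ s \ A, w i * (x i - μ) = ∑ i ∈ s \ A, w i * x i - μ * ∑ i ∈ s \ A, w i := by
      rw [Finset.mul_sum, ← Finset.sum_sub_distrib]
      exact Finset.sum_congr rfl fun i _ => by ring
    rw [this, ← hSB, haB, hμAB]; ring
  -- weighted Cauchy–Schwarz on each bin
  have hCSA : ((1 - a) * SA - a * SB) ^ 2 ≤ a * VA := by
    rw [← hDA, ha, hVA]
    exact Finset.sum_sq_le_sum_mul_sum_of_sq_le_mul A hwA
      (fun i hi => mul_nonneg (hwA i hi) (sq_nonneg _)) (fun i _ => le_of_eq (by ring))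
  have hCSB : ((1 - a) * SA - a * SB) ^ 2 ≤ (1 - a) * VB := by
    rw [← neg_sq, ← hDB, ← haB, hVB]
    exact Finset.sum_sq_le_sum_mul_sum_of_sq_le_mul (s \ A) hwB
      (fun i hi => mul_nonneg (hwB i hi) (sq_nonneg _)) (fun i _ => le_of_eq (by ring))
  -- the total variance splits over the bins
  have hvar : Q - μ ^ 2 = VA + VB := by
    have h1 : ∑ i ∈ s, w i * (x i - μ) ^ 2 = VA + VB := by rw [hVA, hVB]; exact hsplit _
    have h2 : ∑ i ∈ s, w i * (x i - μ) ^ 2 = Q - 2 * μ * μ + μ ^ 2 * 1 := by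
      rw [hQ, ← hw1]
      conv_rhs => rw [show (2 : ℝ) * μ * μ = 2 * μ * ∑ i ∈ s, w i * x i from by rw [← hμ]]
      rw [Finset.mul_sum, Finset.mul_sum, ← Finset.sum_sub_distrib, ← Finset.sum_add_distrib]
      exact Finset.sum_congr rfl fun i _ => by ring
    rw [← h1, h2]; ring
  -- combine
  rw [← ha, ← hSA, ← hSB, ← hμ, ← hQ, hvar]
  calc ((1 - a) * SA - a * SB) ^ 2
      = (1 - a) * ((1 - a) * SA - a * SB) ^ 2 + a * ((1 - a) * SA - a * SB) ^ 2 := by ring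
    _ ≤ (1 - a) * (a * VA) + a * ((1 - a) * VB) :=
        add_le_add (mul_le_mul_of_nonneg_left hCSA hB0) (mul_le_mul_of_nonneg_left hCSB ha0)
    _ = a * (1 - a) * (VA + VB) := by ring

/-- FROM LOCKING TO SLACK (abstract, PROVED): if the bin `A` has mass `a ∈ [b, 1−b]`, the values are
non-negative, and the bin-`A` mean is at most `(1−c)` times the bin-`B` mean (division-free:
`(1−a)·S_A ≤ (1−c)·a·S_B`), then `(1 + c²·b(1−b))·(Σ w x)² ≤ Σ w x²` — a uniform Cauchy–Schwarz /
Jensen slack `s = c²·b(1−b)`.  With `x = χ_z`, `w = W`, `A = {m_z² > θ}` this is exactly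
`LockingResponse → S1` modulo the bookkeeping `pvar = (n−j)E_W[χ]`, `csq = (n−j)²E_W[χ²]`. -/
theorem relVar_of_twoBin {ι : Type*} [DecidableEq ι] (s A : Finset ι) (hA : A ⊆ s) (w x : ι → ℝ)
    (hw : ∀ i ∈ s, 0 ≤ w i) (hw1 : ∑ i ∈ s, w i = 1) (hx : ∀ i ∈ s, 0 ≤ x i)
    {b c : ℝ} (hb : 0 ≤ b) (hc0 : 0 ≤ c)
    (hlo : b ≤ ∑ i ∈ A, w i) (hhi : ∑ i ∈ A, w i ≤ 1 - b)
    (hlock : (1 - ∑ i ∈ A, w i) * (∑ i ∈ A, w i * x i) ≤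
      (1 - c) * (∑ i ∈ A, w i) * (∑ i ∈ s \ A, w i * x i)) :
    (1 + c ^ 2 * (b * (1 - b))) * (∑ i ∈ s, w i * x i) ^ 2 ≤ ∑ i ∈ s, w i * x i ^ 2 := by
  have htwo := var_ge_twoBin s A hA w x hw hw1
  have hsplit : ∀ f : ι → ℝ, ∑ i ∈ s, f i = ∑ i ∈ A, f i + ∑ i ∈ s \ A, f i := fun f => by
    rw [← Finset.sum_union Finset.disjoint_sdiff, Finset.union_sdiff_of_subset hA]
  have hwB : ∀ i ∈ s \ A, 0 ≤ w i := fun i hi => hw i (Finset.mem_sdiff.1 hi).1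
  have hwA : ∀ i ∈ A, 0 ≤ w i := fun i hi => hw i (hA hi)
  obtain ⟨a, ha⟩ : ∃ a : ℝ, a = ∑ i ∈ A, w i := ⟨_, rfl⟩
  obtain ⟨SA, hSA⟩ : ∃ t : ℝ, t = ∑ i ∈ A, w i * x i := ⟨_, rfl⟩
  obtain ⟨SB, hSB⟩ : ∃ t : ℝ, t = ∑ i ∈ s \ A, w i * x i := ⟨_, rfl⟩
  obtain ⟨μ, hμ⟩ : ∃ t : ℝ, t = ∑ i ∈ s, w i * x i := ⟨_, rfl⟩
  obtain ⟨Q, hQ⟩ : ∃ t : ℝ, t = ∑ i ∈ s, w i * x i ^ 2 := ⟨_, rfl⟩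
  rw [← ha, ← hSA, ← hSB, ← hμ, ← hQ] at htwo
  rw [← ha, ← hSA, ← hSB] at hlock
  rw [← ha] at hlo hhi
  rw [← hμ, ← hQ]
  have hμAB : μ = SA + SB := by rw [hμ, hSA, hSB]; exact hsplit _
  have ha0 : 0 ≤ a := le_trans hb hlo
  have hB0 : 0 ≤ 1 - a := by linarith
  have hSA0 : 0 ≤ SA := by rw [hSA]; exact Finset.sum_nonneg fun i hi => mul_nonneg (hwA i hi) (hx i (hA hi))
  have hSB0 : 0 ≤ SB := by
    rw [hSB]; exact Finset.sum_nonneg fun i hi => mul_nonneg (hwB i hi) (hx i (Finset.mem_sdiff.1 hi).1)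
  -- Jensen / Cauchy–Schwarz on all of s: μ² ≤ Q
  have hJ : μ ^ 2 ≤ Q := by
    have := Finset.sum_sq_le_sum_mul_sum_of_sq_le_mul s hw
      (fun i hi => mul_nonneg (hw i hi) (sq_nonneg (x i))) (r := fun i => w i * x i)
      (fun i _ => le_of_eq (by ring))
    rw [hw1, one_mul] at this
    rw [hμ, hQ]; exact this
  -- D ≤ -c a SB ≤ 0, hence D² ≥ (c a SB)²
  have hcaSB : 0 ≤ c * a * SB := mul_nonneg (mul_nonneg hc0 ha0) hSB0
  have hD : (1 - a) * SA - a * SB ≤ -(c * a * SB) := by nlinarith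
  have hD2 : (c * a * SB) ^ 2 ≤ ((1 - a) * SA - a * SB) ^ 2 := by
    nlinarith [mul_nonneg (by linarith : 0 ≤ -((1 - a) * SA - a * SB) - c * a * SB)
      (by linarith : 0 ≤ -((1 - a) * SA - a * SB) + c * a * SB)]
  -- SB ≥ (1 - a) μ ≥ 0
  have hμ0 : 0 ≤ μ := by rw [hμAB]; linarith
  have hSBμ : (1 - a) * μ ≤ SB := by rw [hμAB]; nlinarith
  have hSBμ2 : ((1 - a) * μ) ^ 2 ≤ SB ^ 2 := by
    nlinarith [mul_nonneg hB0 hμ0]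
  -- chain: c² a² (1-a)² μ² ≤ (c a SB)² ≤ D² ≤ a(1-a)(Q - μ²)
  have hchain : a * (1 - a) * (c ^ 2 * (a * (1 - a)) * μ ^ 2) ≤ a * (1 - a) * (Q - μ ^ 2) := by
    have : (c * a) ^ 2 * ((1 - a) * μ) ^ 2 ≤ (c * a) ^ 2 * SB ^ 2 :=
      mul_le_mul_of_nonneg_left hSBμ2 (sq_nonneg _)
    nlinarith
  have hab : b * (1 - b) ≤ a * (1 - a) := by nlinarith
  by_cases hq : a * (1 - a) = 0
  · have hb0 : b * (1 - b) = 0 := le_antisymm (hq ▸ hab) (mul_nonneg hb (by linarith))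
    rw [hb0]; nlinarith
  · have hpos : 0 < a * (1 - a) := lt_of_le_of_ne (mul_nonneg ha0 hB0) (Ne.symm hq)
    have hkey : c ^ 2 * (a * (1 - a)) * μ ^ 2 ≤ Q - μ ^ 2 := le_of_mul_le_mul_left hchain hpos
    have : c ^ 2 * (b * (1 - b)) * μ ^ 2 ≤ c ^ 2 * (a * (1 - a)) * μ ^ 2 :=
      mul_le_mul_of_nonneg_right (mul_le_mul_of_nonneg_left hab (sq_nonneg c)) (sq_nonneg μ)
    nlinarith

/-! ## 3. The bridge split lands on canonical open non-triviality -/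

/-- BINDER-CUMULANT FLOOR (finite-size renormalised coupling bounded away from its Gaussian value;
free b.c., `β = β_c(3)`, `h = 0`): `∃ g > 0, ⟨M⁴⟩ ≤ (3 − g)·⟨M²⟩²` for all large boxes.  Lebowitz'
inequality gives `g ≥ 0`; `g > 0` uniformly in `L` is hyperscaling / non-triviality of the 3D
Ising scaling limit — the open problem itself (Aizenman 2021 §11(1)). -/
def BinderCumulantFloor : Prop :=
  ∃ g : ℝ, 0 < g ∧ ∃ L₀ : ℕ, ∀ L ≥ L₀,
    isingExpect (zdGraph 3) (box 3 L) βc 0 .free (fun σ => Mtot L σ ^ 4) ≤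
      (3 - g) * isingExpect (zdGraph 3) (box 3 L) βc 0 .free (fun σ => Mtot L σ ^ 2) ^ 2

/-- PINNING STABILITY (the mechanism half of the bridge split `PED ⇐ BinderCumulantFloor ∧
(BinderCumulantFloor → PED)`): IR non-Gaussianity of the block spin forces value-dependent screening,
hence `e* < 1`.  Unproved; it is the converse direction of the route's own dictionary r3. -/
def PinningStabilityBridge : Prop :=
  BinderCumulantFloor → PinningEfficiencyDeficit

/-- The bridge split assembles trivially (modus ponens); recorded so the census can point at the
exact residual pieces. -/
theorem deficit_of_bridge : BinderCumulantFloor → PinningStabilityBridge → PinningEfficiencyDeficit :=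
  fun hB hS => hS hB

end

end Summit.CriticalPhenomena.Ising3DConformalLimit.Cruxes.PinningEfficiencyDeficit.StratS3
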